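import Summits.HodgeConjecture.HodgeConjecture.Theorems.Ring2AbelianAllAndreTwistedProductRows
import Literature.AlgebraicGeometry.HodgeTheory.WeilClassesDescendingOfLefschetzOneOne
import HarnessLib

/-!
# Ring 2 · sub-cell AbelianAll (ALL ABELIAN VARIETIES), André axis, part XLVIII-g — THE DUAL TRIPLE IS AUTOMATIC: of the nine pairings of part
# XLVIII-b/c six VANISH on every Weil-type member (`E± · E± = 0`; `θⁿ ⊥ E±` for a `K`-invariant `θ` of weight `Nm`), so the row needs only the three
# normalisations `∫θθ' = ∫u₊u'₋ = ∫u₋u'₊ = 1`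

HONEST FRAMING (page 1, verbatim): **research route, not a corollary; conditional on HC_CM plus one named
minimal statement.** Cell line: research route conditional on HC_CM; not a corollary; Q11.4-sentence-2
already refuted in dim ≥ 3. Nothing in this file proves a case of the Hodge conjecture or of `B(X)` for a named `X`; `HC_CM`, `HC_AV` and the global
nodes do NOT occur; the row of §3 has the inputs of part XLVIII-c (Weil planes of the twisted products — HYPOTHESIS; Verdier — NAMED-FACT BINDER).
Item `Theses.RankFourFaces.CMToAbelian` (stmt-16267) stays OPEN; N104 untouched; no node is born (0 `def`, 0 `sorry`). Seat `pub-hodge-ring2-ab-andre-2`,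
gen 40 (part XLVIII; owed item (o147) in part: binders of the Weil rows discharged from the tree's Weil structures).

## Content (theorems only; standard axioms; fact-free except §3's binders)

* §1 ON A WEIL-TYPE ABELIAN VARIETY `(B, ψ)` (`dim B = 2n`, `ψ ≫ ψ = −d`, `n, d ≥ 1`; `H•(B(ℂ)) = ⋀•H¹` and `b₁ = 4n` are THEOREMS of the tree):
  **`cupProduct_eq_zero_of_mem_weilClassesPlus₂`** / **`…Minus₂`** — `u ⌣ u' = 0` for `u, u'` in the same Weil line (`E±` is a line squaring to zero,
  the tree's `exists_weilLines_generators`); **`map_test_top_eq_smul`** — every top class `z ∈ H^{4n}(B)` satisfies `(x𝟙 + yψ)^* z = (x² + y²d)^{2n} z`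
  (the top line is spanned by `E₊ ⌣ E₋`); **`cupProduct_eq_zero_of_weight_of_mem_weilClassesPlus`** / **`…Minus`** — a class `θ' ∈ H^{2n}(B)` of
  WEIGHT `(x² + y²d)ⁿ` under the test endomorphisms (the `K`-invariant classes, e.g. `θⁿ` for a polarisation `θ` with `ψ^*θ = dθ`, van Geemen 5.2 (1))
  has `θ' ⌣ w = 0` for every `w ∈ E±` (the characters `(x² + y²d)ⁿ(x ± iy√d)^{2n}` and `(x² + y²d)^{2n}` of a non-zero top class would agree on `ℕ²`,
  forcing `(x + i√d)ⁿ = (x − i√d)ⁿ` for all `x` — the tree's `eq_zero_of_forall_natCast_add_pow_eq`).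
* §2 **`traceC_cupProduct_map_fiberι_eq_zero_of_chart`** — transport to a member `X_t` along a chart `e_t : A_t ≅ X_t`: the fibre pairing
  `∫_{X_t} j_t^*U ∪ j_t^*U'` vanishes whenever `e_t^*(j_t^*U) ⌣ e_t^*(j_t^*U') = 0` on `A_t`.
* §3 **`betaInverse_of_weilPlanes_twistedProd_of_weights_of_verdier`** — part XLVIII-c's row `betaInverse_of_weilPlanes_twistedProd_of_verdier` with the
  SIX VANISHING PAIRINGS DISCHARGED: hypotheses are the three normalisations, the span, the weights of `θ_t = j_t^*Θ` and `θ'_t = j_t^*Θ'`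
  (`e_t^*θ_t, e_t^*θ'_t` of weight `(x² + y²d_K)ⁿ`), the Weil-line memberships, the charts and the twisted `Φ_s`; conclusion β at `t` in degree `2n`.

## Honest status

Hypothesis reduction only (six displayed pairings become consequences of the Weil structure at `t`); the open input and its strength are those of
part XLVIII-c (Weil-HC for the split-type twisted products `X_s × X̄_t` on uncountably many members, + Verdier). Nothing minimal is claimed; N104
untouched. EDGE LABELS: K (§1–§2), K[Weil planes of twisted products, Verdier] (§3).
References: vanGeemen1994HodgeAV (4.9, Lemma 5.2 (1), (6), proof of Thm. 6.12); Schoen1998HodgeWeilAddendum (§10); DeligneMilne1982 (§4 (4.4));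
Verdier1976 (Cor. (5.1)); HatcherAT2002 (§3.2 Prop. 3.10, §3.3 Thm. 3.26).
-/

noncomputable section

set_option linter.dupNamespace false

namespace Summit.HodgeConjecture.HodgeConjecture.Ring2.AbelianAll

open CategoryTheory CategoryTheory.Limits AlgebraicGeometry MonoidalCategory CartesianMonoidalCategory
open Literature.AlgebraicGeometry Literature.AlgebraicGeometry.Motives
open Literature.AlgebraicGeometry.HodgeTheory
open Literature.AlgebraicTopology.SingularHomology (singularCohomology cupProduct cupProduct_map)
open Summit.HodgeConjecture.HodgeConjecture.Theorems (deg_fiberGysin_aux)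

/-! ## §1 Vanishing pairings on a Weil-type abelian variety -/

section Weil

variable {B : Motives.AbelianVariety ℂ} {n d : ℕ} (hn : 0 < n) (hd : 0 < d) (hB : B.dim = 2 * n) {ψ : B ⟶ B} (hψ : ψ ≫ ψ = -(d • 𝟙 B))

include hn hd hB hψ

/-- **`u ⌣ u' = 0` for two classes of the Weil line `E₊`** (`E₊ = ⋀^{2n}V₊` is a line squaring to zero in `⋀^{4n}H¹`; any target degree `k`).
[cite: vanGeemen1994HodgeAV, proof of Thm. 6.12] -/
theorem cupProduct_eq_zero_of_mem_weilClassesPlus₂ {k : ℕ} (hk : 2 * n + 2 * n = k) {u u' : complexBetti B.X (2 * n)}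
    (hu : u ∈ weilClassesPlus B ψ n d) (hu' : u' ∈ weilClassesPlus B ψ n d) : cupProduct hk u u' = 0 := by
  subst hk
  have hb₁ : Module.finrank ℂ (complexBetti B.X 1) = 2 * (2 * n) := by rw [Motives.AbelianVariety.finrank_complexBetti_one, hB]
  have hΛ := Motives.AbelianVariety.hasExteriorCohomologyH1_complexPoints B
  obtain ⟨P, M, hPE, -, hPM, hPP, -⟩ := exists_weilLines_generators hb₁ hn hd hψ
  have hP0 : P ≠ 0 := fun h ↦ hPM (by rw [h, LinearMap.map_zero₂])
  obtain ⟨α, rfl⟩ := Submodule.mem_span_singleton.mp (weilClassesPlus_le_span_singleton hΛ hb₁ hd hψ hPE hP0 hu)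
  obtain ⟨α', rfl⟩ := Submodule.mem_span_singleton.mp (weilClassesPlus_le_span_singleton hΛ hb₁ hd hψ hPE hP0 hu')
  rw [LinearMap.map_smul₂, map_smul, hPP, smul_zero, smul_zero]

/-- **`u ⌣ u' = 0` for two classes of the Weil line `E₋`.** [cite: vanGeemen1994HodgeAV, proof of Thm. 6.12] -/
theorem cupProduct_eq_zero_of_mem_weilClassesMinus₂ {k : ℕ} (hk : 2 * n + 2 * n = k) {u u' : complexBetti B.X (2 * n)}
    (hu : u ∈ weilClassesMinus B ψ n d) (hu' : u' ∈ weilClassesMinus B ψ n d) : cupProduct hk u u' = 0 := by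
  subst hk
  have hb₁ : Module.finrank ℂ (complexBetti B.X 1) = 2 * (2 * n) := by rw [Motives.AbelianVariety.finrank_complexBetti_one, hB]
  have hΛ := Motives.AbelianVariety.hasExteriorCohomologyH1_complexPoints B
  obtain ⟨P, M, -, hME, hPM, -, hMM⟩ := exists_weilLines_generators hb₁ hn hd hψ
  have hM0 : M ≠ 0 := fun h ↦ hPM (by rw [h, LinearMap.map_zero])
  obtain ⟨β, rfl⟩ := Submodule.mem_span_singleton.mp (weilClassesMinus_le_span_singleton hΛ hb₁ hd hψ hME hM0 hu)
  obtain ⟨β', rfl⟩ := Submodule.mem_span_singleton.mp (weilClassesMinus_le_span_singleton hΛ hb₁ hd hψ hME hM0 hu')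
  rw [LinearMap.map_smul₂, map_smul, hMM, smul_zero, smul_zero]

/-- **THE TOP CLASSES HAVE WEIGHT `(x² + y²d)^{2n}`**: `(x𝟙 + yψ)^* z = (x² + y²d)^{2n} • z` for every `z ∈ H^{2m}(B(ℂ))`, `2m = 4n` the top degree —
the top line is spanned by `P ⌣ M` (`P ∈ E₊`, `M ∈ E₋`, `P ⌣ M ≠ 0`; `H^{2m}` is a line, the canonical trace), a joint eigenclass for
`(x + iy√d)^{2n}(x − iy√d)^{2n} = (x² + y²d)^{2n}`. (In print: `deg(x𝟙 + yψ) = Nm(x + y√−d)^{2n}`.)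
[cite: vanGeemen1994HodgeAV, proof of Lemma 5.2 (6) and of Thm. 6.12] [cite: HatcherAT2002, §3.3 Thm. 3.26] -/
theorem map_test_top_eq_smul {m : ℕ} (hm : 2 * n + 2 * n = 2 * m) (x y : ℕ) (z : complexBetti B.X (2 * m)) :
    complexBetti.map (x • 𝟙 B + y • ψ).hom.hom.hom (2 * m) z = (((x * x + y * y * d : ℕ) : ℂ) ^ (2 * n)) • z := by
  have hb₁ : Module.finrank ℂ (complexBetti B.X 1) = 2 * (2 * n) := by rw [Motives.AbelianVariety.finrank_complexBetti_one, hB]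
  have hBsp : IsSmoothProjective m B.X := by
    rw [show m = B.dim by omega]
    exact Motives.AbelianVariety.isSmoothProjective_holds
  obtain ⟨P, M, hPE, hME, hPM, -, -⟩ := exists_weilLines_generators hb₁ hn hd hψ
  have hP0 : P ≠ 0 := fun h ↦ hPM (by rw [h, LinearMap.map_zero₂])
  have hM0 : M ≠ 0 := fun h ↦ hPM (by rw [h, LinearMap.map_zero])
  have hPM' : cupProduct hm P M ≠ 0 := cupProduct_ne_zero_of_mem_weilClassesPlus_of_mem_weilClassesMinus hb₁ hn hd hψ hm hPE hME hP0 hM0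
  -- `P ⌣ M` is a joint eigenclass of weight `(x+iy√d)^{2n} (x−iy√d)^{2n}`
  have hPMχ := cupProduct_mem_pullbackEigenclasses hm hPE hME
  have hχ : ((x : ℂ) + (y : ℂ) * Complex.I * (Real.sqrt d : ℂ)) ^ (2 * n) * ((x : ℂ) - (y : ℂ) * Complex.I * (Real.sqrt d : ℂ)) ^ (2 * n) =
      ((x * x + y * y * d : ℕ) : ℂ) ^ (2 * n) := by
    rw [← mul_pow, natCast_add_mul_I_mul_sqrt_mul_sub]
  -- every top class is a multiple of `P ⌣ M`
  have htr : traceC hBsp (cupProduct hm P M) ≠ 0 := fun h ↦ hPM' (eq_zero_of_traceC_eq_zero hBsp h)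
  have hz : z = (traceC hBsp z * (traceC hBsp (cupProduct hm P M))⁻¹) • cupProduct hm P M := by
    apply traceC_injective hBsp
    rw [map_smul, smul_eq_mul, mul_assoc, inv_mul_cancel₀ htr, mul_one]
  rw [hz, map_smul]
  erw [(mem_pullbackEigenclasses_iff.1 hPMχ) x y]
  rw [hχ, smul_comm]

/-- **A CLASS OF WEIGHT `(x² + y²d)ⁿ` IS ORTHOGONAL TO THE WEIL LINE `E₊`**: if `θ' ∈ H^{2n}(B)` satisfies `(x𝟙 + yψ)^* θ' = (x² + y²d)ⁿ θ'` for all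
`x, y ∈ ℕ` (e.g. `θ' = θⁿ` for a polarisation class `θ` of `ψ^*`-weight `d`, van Geemen Lemma 5.2 (1)) and `w ∈ E₊`, then `θ' ⌣ w = 0` (in the top
degree `2m = 4n`): otherwise the non-zero top class `θ' ⌣ w` would have the two weights `(x² + y²d)ⁿ(x + iy√d)^{2n}` and `(x² + y²d)^{2n}`, whence
`(x + i√d)ⁿ = (x − i√d)ⁿ` for every `x ∈ ℕ`, absurd. [cite: vanGeemen1994HodgeAV, Lemma 5.2 (1) and proof of Thm. 6.12] -/
theorem cupProduct_eq_zero_of_weight_of_mem_weilClassesPlus {m : ℕ} (hm : 2 * n + 2 * n = 2 * m) {θ' w : complexBetti B.X (2 * n)}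
    (hθ' : θ' ∈ pullbackEigenclasses B ψ (2 * n) fun x y ↦ ((x * x + y * y * d : ℕ) : ℂ) ^ n) (hw : w ∈ weilClassesPlus B ψ n d) :
    cupProduct hm θ' w = 0 := by
  by_contra hne
  have hzχ := cupProduct_mem_pullbackEigenclasses hm hθ' hw
  -- compare the two weights at `(x, 1)`
  have key : ∀ x : ℕ, ((x : ℂ) + Complex.I * (Real.sqrt d : ℂ)) ^ n = ((x : ℂ) - Complex.I * (Real.sqrt d : ℂ)) ^ n := by
    intro x
    have h1 := (mem_pullbackEigenclasses_iff.1 hzχ) x 1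
    have h2 := map_test_top_eq_smul hn hd hB hψ hm x 1 (cupProduct hm θ' w)
    erw [h1] at h2
    have h3 := sub_eq_zero.2 h2
    rw [← sub_smul, smul_eq_zero] at h3
    have h4 := sub_eq_zero.1 (h3.resolve_right hne)
    -- `N^n α^{2n} = N^{2n}` with `N = α β`, `α = x + i√d ≠ 0`, `β = x − i√d`
    set α : ℂ := (x : ℂ) + ((1 : ℕ) : ℂ) * Complex.I * (Real.sqrt d : ℂ) with hα
    set β : ℂ := (x : ℂ) - ((1 : ℕ) : ℂ) * Complex.I * (Real.sqrt d : ℂ) with hβ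
    have hαβ : α * β = ((x * x + 1 * 1 * d : ℕ) : ℂ) := natCast_add_mul_I_mul_sqrt_mul_sub x 1 d
    have hα0 : α ≠ 0 := natCast_add_mul_I_mul_sqrt_ne_zero hd x one_ne_zero
    rw [← hαβ] at h4
    have h5 : (α * β) ^ n * α ^ n * α ^ n = (α * β) ^ n * α ^ n * β ^ n :=
      calc (α * β) ^ n * α ^ n * α ^ n = (α * β) ^ n * α ^ (2 * n) := by ring
        _ = (α * β) ^ (2 * n) := h4
        _ = (α * β) ^ n * α ^ n * β ^ n := by ring
    have hαβn : (α * β) ^ n * α ^ n ≠ 0 := mul_ne_zero (pow_ne_zero _ (by rw [hαβ]; exact Nat.cast_ne_zero.2 (by positivity))) (pow_ne_zero _ hα0)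
    have h6 := mul_left_cancel₀ hαβn h5
    simpa only [hα, hβ, Nat.cast_one, one_mul] using h6
  exact I_mul_sqrt_ne_zero hd (eq_zero_of_forall_natCast_add_pow_eq hn key)

/-- **… and to the Weil line `E₋`** (the same computation with the other sign). [cite: vanGeemen1994HodgeAV, Lemma 5.2 (1) and proof of Thm. 6.12] -/
theorem cupProduct_eq_zero_of_weight_of_mem_weilClassesMinus {m : ℕ} (hm : 2 * n + 2 * n = 2 * m) {θ' w : complexBetti B.X (2 * n)}
    (hθ' : θ' ∈ pullbackEigenclasses B ψ (2 * n) fun x y ↦ ((x * x + y * y * d : ℕ) : ℂ) ^ n) (hw : w ∈ weilClassesMinus B ψ n d) :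
    cupProduct hm θ' w = 0 := by
  by_contra hne
  have hzχ := cupProduct_mem_pullbackEigenclasses hm hθ' hw
  have key : ∀ x : ℕ, ((x : ℂ) + Complex.I * (Real.sqrt d : ℂ)) ^ n = ((x : ℂ) - Complex.I * (Real.sqrt d : ℂ)) ^ n := by
    intro x
    have h1 := (mem_pullbackEigenclasses_iff.1 hzχ) x 1
    have h2 := map_test_top_eq_smul hn hd hB hψ hm x 1 (cupProduct hm θ' w)
    erw [h1] at h2
    have h3 := sub_eq_zero.2 h2
    rw [← sub_smul, smul_eq_zero] at h3
    have h4 := sub_eq_zero.1 (h3.resolve_right hne)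
    set α : ℂ := (x : ℂ) + ((1 : ℕ) : ℂ) * Complex.I * (Real.sqrt d : ℂ) with hα
    set β : ℂ := (x : ℂ) - ((1 : ℕ) : ℂ) * Complex.I * (Real.sqrt d : ℂ) with hβ
    have hαβ : α * β = ((x * x + 1 * 1 * d : ℕ) : ℂ) := natCast_add_mul_I_mul_sqrt_mul_sub x 1 d
    have hβ0 : β ≠ 0 := natCast_sub_mul_I_mul_sqrt_ne_zero hd x one_ne_zero
    rw [← hαβ] at h4
    have h5 : (α * β) ^ n * β ^ n * β ^ n = (α * β) ^ n * β ^ n * α ^ n :=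
      calc (α * β) ^ n * β ^ n * β ^ n = (α * β) ^ n * β ^ (2 * n) := by ring
        _ = (α * β) ^ (2 * n) := h4
        _ = (α * β) ^ n * β ^ n * α ^ n := by ring
    have hαβn : (α * β) ^ n * β ^ n ≠ 0 := mul_ne_zero (pow_ne_zero _ (by rw [hαβ]; exact Nat.cast_ne_zero.2 (by positivity))) (pow_ne_zero _ hβ0)
    have h6 := mul_left_cancel₀ hαβn h5
    simpa only [hα, hβ, Nat.cast_one, one_mul] using h6.symm
  exact I_mul_sqrt_ne_zero hd (eq_zero_of_forall_natCast_add_pow_eq hn key)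

end Weil

/-! ## §2 Transport of the vanishing to the fibre pairing of a member -/

section Chart

variable {𝒳 S : SchemeOver ℂ} {d : ℕ} {f : 𝒳 ⟶ S} (hf : IsCompactAbelianPencil f d)

/-- `𝐣[s, k]` — `j_s^*` as a linear map (display notation). [cite: VoisinHodgeI2002, §7.3.2] -/
local notation3 (prettyPrint := false) "𝐣[" s ", " k "]" => (complexBetti.map (fiberι f s) k).hom

include hf in
/-- **The fibre pairing vanishes when the charted classes multiply to zero**: for a chart `e_t : A_t ≅ X_t` and classes `a, b` on `X_t` with
`e_t^* a ⌣ e_t^* b = 0` on `A_t`, `∫_{X_t} a ∪ b = 0` (`e_t^*` is a ring isomorphism). [cite: HatcherAT2002, §3.2 Prop. 3.10] -/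
theorem traceC_cupProduct_eq_zero_of_chart (t : ComplexPoints S) {p q : ℕ} (h : 2 * p + 2 * q = 2 * d) (A : AbelianVariety ℂ)
    (e : A.X ≅ fiberOver f t) (a : complexBetti (fiberOver f t) (2 * p)) (b : complexBetti (fiberOver f t) (2 * q))
    (hab : cupProduct h (complexBetti.map e.hom (2 * p) a) (complexBetti.map e.hom (2 * q) b) = 0) :
    traceC (hf.isSmoothProjective_fiberOver t) (cupProduct h a b) = 0 := by
  have h0 : complexBetti.map e.hom (2 * d) (cupProduct h a b) = 0 := by rw [cupProduct_map, hab]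
  have h1 : cupProduct h a b = 0 := by
    have := congrArg (complexBetti.map e.inv (2 * d)) h0
    rwa [← complexBetti.map_comp_apply, e.inv_hom_id, complexBetti.map_id, map_zero] at this
  rw [h1, map_zero]

end Chart

/-! ## §3 The row with the six vanishing pairings discharged -/

section Row

variable {𝒳 S : SchemeOver ℂ} {d : ℕ} {f : 𝒳 ⟶ S} (hf : IsCompactAbelianPencil f d)

/-- `𝐆[hf, s, k]` — `j_{s*}` for the complex orientations (display notation, as in part XL-a). [cite: FultonYoungTableaux1997, Appendix B §B.1 (5)] -/
local notation3 (prettyPrint := false) "𝐆[" hf ", " s ", " k "]" =>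
  complexGysin complexOrientationFamily (IsCompactAbelianPencil.isSmoothProjective_fiberOver hf s)
    (IsCompactAbelianPencil.isSmoothProjective_total hf) (fiberι f s) (deg_fiberGysin_aux k d)

/-- `𝐣[s, k]` — `j_s^*` as a linear map (display notation). [cite: VoisinHodgeI2002, §7.3.2] -/
local notation3 (prettyPrint := false) "𝐣[" s ", " k "]" => (complexBetti.map (fiberι f s) k).hom

/-- `∫[hf, t]` — the canonical complex trace of the fibre `X_t` (display notation for the tree's `traceC`). [cite: HatcherAT2002, §3.3 p. 241] -/
local notation3 (prettyPrint := false) "∫[" hf ", " t "]" => traceC (IsCompactAbelianPencil.isSmoothProjective_fiberOver hf t)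

/-- **β FROM THE WEIL PLANES OF THE TWISTED PRODUCTS, THE SIX VANISHING PAIRINGS DISCHARGED.** Part XLVIII-c's
`betaInverse_of_weilPlanes_twistedProd_of_verdier` with `hθm hθp hpθ hpp hmθ hmm` replaced by the WEIGHTS of `θ_t = j_t^*Θ`, `θ'_t = j_t^*Θ'` on the chart
`A_t` (`(x𝟙 + yφ_t)^*` acts by `(x² + y²d_K)ⁿ`: the `K`-invariant classes `θⁿ`, `θⁿ/deg`) — §1 on `A_t` for the members `u±(t)`, `u'∓(t)` of the Weil
lines. Remaining displayed inputs: `∫θθ' = ∫u₊u'₋ = ∫u₋u'₊ = 1`, the span `I_t^{2n} = ℂθ_t + ℂu₊(t) + ℂu₋(t)`, `θ_s`/`θ'_t` algebraic, the per-member Weil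
structures and twisted `Φ_s`, algebraic Weil planes of `(A_s × A_t, Φ_s)` for uncountably many `s`, Verdier.
[cite: vanGeemen1994HodgeAV, 4.9, Lemma 5.2 (1) and (6)] [cite: Verdier1976, Cor. (5.1)] [cite: Schoen1998HodgeWeilAddendum, §10 (proof of the Proposition)] -/
theorem betaInverse_of_weilPlanes_twistedProd_of_weights_of_verdier (hGT : Verdier1976_genericLocalTriviality) (t : ComplexPoints S) {n : ℕ}
    (hn : n + n = d) (hn0 : 0 < n) (Θ Up Um Θ' U'm U'p : complexBetti 𝒳 (2 * n))
    (hθθ : ∫[hf, t] (cupProduct (show 2 * n + 2 * n = 2 * d by omega) (𝐣[t, 2 * n] Θ) (𝐣[t, 2 * n] Θ')) = 1)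
    (hpm : ∫[hf, t] (cupProduct (show 2 * n + 2 * n = 2 * d by omega) (𝐣[t, 2 * n] Up) (𝐣[t, 2 * n] U'm)) = 1)
    (hmp : ∫[hf, t] (cupProduct (show 2 * n + 2 * n = 2 * d by omega) (𝐣[t, 2 * n] Um) (𝐣[t, 2 * n] U'p)) = 1)
    (hspan : ∀ W : complexBetti 𝒳 (2 * n), ∃ a b c : ℂ, 𝐣[t, 2 * n] W = a • 𝐣[t, 2 * n] Θ + b • 𝐣[t, 2 * n] Up + c • 𝐣[t, 2 * n] Um)
    (hΘ : ∀ s : ComplexPoints S, 𝐣[s, 2 * n] Θ ∈ algebraicClasses (fiberOver f s) n) (hΘ' : 𝐣[t, 2 * n] Θ' ∈ algebraicClasses (fiberOver f t) n)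
    {dK : ℕ} (hdK : 0 < dK) (A : ComplexPoints S → AbelianVariety ℂ) (e : ∀ s, (A s).X ≅ fiberOver f s) (φ : ∀ s, A s ⟶ A s)
    (hφ : ∀ s, φ s ≫ φ s = -(dK • 𝟙 (A s))) (Φ : ∀ s, (A s).prod (A t) ⟶ (A s).prod (A t))
    (hΦ₁ : ∀ s, Φ s ≫ Motives.AbelianVariety.fst (A s) (A t) = Motives.AbelianVariety.fst (A s) (A t) ≫ φ s)
    (hΦ₂ : ∀ s, Φ s ≫ Motives.AbelianVariety.snd (A s) (A t) = Motives.AbelianVariety.snd (A s) (A t) ≫ (-φ t))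
    (hΘχ : complexBetti.map (e t).hom (2 * n) (𝐣[t, 2 * n] Θ) ∈ pullbackEigenclasses (A t) (φ t) (2 * n) fun x y ↦ ((x * x + y * y * dK : ℕ) : ℂ) ^ n)
    (hΘ'χ : complexBetti.map (e t).hom (2 * n) (𝐣[t, 2 * n] Θ') ∈ pullbackEigenclasses (A t) (φ t) (2 * n) fun x y ↦ ((x * x + y * y * dK : ℕ) : ℂ) ^ n)
    (hUp : ∀ s, complexBetti.map (e s).hom (2 * n) (𝐣[s, 2 * n] Up) ∈ weilClassesPlus (A s) (φ s) n dK)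
    (hUm : ∀ s, complexBetti.map (e s).hom (2 * n) (𝐣[s, 2 * n] Um) ∈ weilClassesMinus (A s) (φ s) n dK)
    (hU'm : complexBetti.map (e t).hom (2 * n) (𝐣[t, 2 * n] U'm) ∈ weilClassesMinus (A t) (φ t) n dK)
    (hU'p : complexBetti.map (e t).hom (2 * n) (𝐣[t, 2 * n] U'p) ∈ weilClassesPlus (A t) (φ t) n dK)
    (hW : ¬ {s : ComplexPoints S | weilClassesOf ((A s).prod (A t)) (Φ s) (n + n) dK ≤ algebraicClasses ((A s).prod (A t)).X (n + n)}.Countable) :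
    ∃ T : complexBetti 𝒳 (2 * n + 2) →ₗ[ℂ] complexBetti 𝒳 (2 * n), IsAlgebraicCorrespondence (d + 1) (d + 1) 𝒳 𝒳 T ∧
      ∀ W, 𝐣[t, 2 * n] (T (𝐆[hf, t, 2 * n] (𝐣[t, 2 * n] W))) = 𝐣[t, 2 * n] W := by
  have hAt : (A t).dim = 2 * n := by rw [Andre1996.compactPencil_dim_eq_of_iso hf (e t), ← hn, two_mul]
  have h2 : 2 * n + 2 * n = 2 * d := by omega
  -- the six vanishing pairings, on the chart `A_t`
  have hθm : ∫[hf, t] (cupProduct h2 (𝐣[t, 2 * n] Θ) (𝐣[t, 2 * n] U'm)) = 0 :=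
    traceC_cupProduct_eq_zero_of_chart hf t h2 (A t) (e t) _ _
      (cupProduct_eq_zero_of_weight_of_mem_weilClassesMinus hn0 hdK hAt (hφ t) h2 hΘχ hU'm)
  have hθp : ∫[hf, t] (cupProduct h2 (𝐣[t, 2 * n] Θ) (𝐣[t, 2 * n] U'p)) = 0 :=
    traceC_cupProduct_eq_zero_of_chart hf t h2 (A t) (e t) _ _
      (cupProduct_eq_zero_of_weight_of_mem_weilClassesPlus hn0 hdK hAt (hφ t) h2 hΘχ hU'p)
  have hpp : ∫[hf, t] (cupProduct h2 (𝐣[t, 2 * n] Up) (𝐣[t, 2 * n] U'p)) = 0 :=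
    traceC_cupProduct_eq_zero_of_chart hf t h2 (A t) (e t) _ _ (cupProduct_eq_zero_of_mem_weilClassesPlus₂ hn0 hdK hAt (hφ t) h2 (hUp t) hU'p)
  have hmm : ∫[hf, t] (cupProduct h2 (𝐣[t, 2 * n] Um) (𝐣[t, 2 * n] U'm)) = 0 :=
    traceC_cupProduct_eq_zero_of_chart hf t h2 (A t) (e t) _ _ (cupProduct_eq_zero_of_mem_weilClassesMinus₂ hn0 hdK hAt (hφ t) h2 (hUm t) hU'm)
  -- `u± ⌣ θ'`: graded commutativity reduces to `θ' ⌣ u±` on the chart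
  have hpθ : ∫[hf, t] (cupProduct h2 (𝐣[t, 2 * n] Up) (𝐣[t, 2 * n] Θ')) = 0 := by
    refine traceC_cupProduct_eq_zero_of_chart hf t h2 (A t) (e t) _ _ ?_
    rw [Literature.AlgebraicTopology.SingularHomology.cupProduct_gradedComm_holds ℂ _ h2 h2,
      cupProduct_eq_zero_of_weight_of_mem_weilClassesPlus hn0 hdK hAt (hφ t) h2 hΘ'χ (hUp t), smul_zero]
  have hmθ : ∫[hf, t] (cupProduct h2 (𝐣[t, 2 * n] Um) (𝐣[t, 2 * n] Θ')) = 0 := by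
    refine traceC_cupProduct_eq_zero_of_chart hf t h2 (A t) (e t) _ _ ?_
    rw [Literature.AlgebraicTopology.SingularHomology.cupProduct_gradedComm_holds ℂ _ h2 h2,
      cupProduct_eq_zero_of_weight_of_mem_weilClassesMinus hn0 hdK hAt (hφ t) h2 hΘ'χ (hUm t), smul_zero]
  exact betaInverse_of_weilPlanes_twistedProd_of_verdier hf hGT t hn Θ Up Um Θ' U'm U'p hθθ hθm hθp hpθ hpm hpp hmθ hmm hmp hspan hΘ hΘ' hdK A e φ hφ
    Φ hΦ₁ hΦ₂ hUp hUm hU'm hU'p hW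

end Row

end Summit.HodgeConjecture.HodgeConjecture.Ring2.AbelianAll

end
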